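import Summits.BirchSwinnertonDyer.Rank1Residual.WAll.TargetCMTwoInertShuZhaiOneFortyFour
import Summits.BirchSwinnertonDyer.Rank1Residual.P2.KrizLiSmallCMBase
import HarnessLib
import HarnessLib.Audit.Tags

/-!
# Rung W-ALL of ladder BSD (D-0120) — the INERT slices of row 12₂ cut a FOURTH time, flag-free: ON / OFF the
# `ℚ`-isogeny classes of the GENERIC Kriz–Li (★)-door (any CM base of conductor `< 5000`, any Heegner field)

Cell `bsd-print-cf2` (D-0131 (2) PRINT TIER), prover p3 g3. HONEST FRAMING: the leaf `WAllCornerFTwo` (every CM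
curve of analytic rank one satisfies Miller's `BSD(E,2)`) is OPEN AS A CLASS; every cut below is EXACT (excluded
middle on a membership predicate), nothing class-wide is claimed, no named fact is introduced. After p4's
`WAll/TargetCMTwoSlices.lean` (five slices by the type of `2` in `K_CM`), p3's SZ36 cut, p3 g2's KL243 cut and p4
g2's SZ144 cut (`WAll/TargetCMTwoInertShuZhaiOneFortyFour.lean`, residual v3
`WAllCornerFTwoInertOffShuZhaiOffKrizLiOffShuZhaiOneFortyFour`), this file cuts the inert residual ONCE MORE along
the generic Kriz–Li family `P2.IsIsogenousToKrizLiTwistOfSmallCMBase` (`P2/KrizLiSmallCMBase.lean`, p556676: `W`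
`ℚ`-isogenous to `E^{(d)}` or `E^{(d·d_K)}` for SOME globally minimal CM base `E` with `N_E < 5000`, a rational
point of infinite order, `E(ℚ)[2] = 0`, `c₂(E)` odd, SOME imaginary quadratic `K` with the Heegner hypothesis and
a (★)-datum `P2.HasKrizLiStarDatum E K`, SOME `d ∈ 𝒩(E, K)` with `χ_d(−N_E) = 1`):

| slice `Prop` | shape (all `∀ W [..] [..], W.HasCM → W.analyticRank = 1 → CMInert W 2 → …`) | status |
|---|---|---|
| `WAllCornerFTwoInertKrizLiStarDoor` (here) | `… → P2.IsIsogenousToKrizLiTwistOfSmallCMBase W → BSDp W 2` | CLOSED granted 7 facts (§3) |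
| `WAllCornerFTwoInertOffShuZhaiOffKrizLiOffShuZhaiOneFortyFourOffStarDoor` (here) | `… → ¬SZ36 → ¬KL243 → ¬SZ144 → ¬(★)-door → BSDp W 2` | OPEN (residual v4) |

The ON-leaf is the W-ALL twin of route PrintCf2's aside 21366 `InertKrizLiStarDoorOfFactsPlus` (planner g4,
rev 14), whose MEMBER package records `r_an(E) = 1` where `P2.IsIsogenousToKrizLiTwistOfSmallCMBase` records
`1 ≤ rank_ℤ E(ℚ)` and packages the (★)-datum as `HasKrizLiStarDatum`: the two memberships are EQUIVALENT granted
GZK one way and Thm 4.3 + Burungale–Flach + modularity the other (§2), so `leaf ⟺ aside-consequent` granted those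
facts (`wAllCornerFTwoInertKrizLiStarDoor_iff_item_of_facts`). It CONTAINS the KL243 leaf granted the printed
Table-1 row (`wAllCornerFTwoInertKrizLiTwoFortyThree_of_starDoor`) and, by p3's `P2/KrizLiCubeSumThirteen*`, the
`ℚ`-isogeny classes of the twists of the Sylvester cube-sum curve `x³ + y³ = 13` granted its certificate.
Currency of the closure: LITERAL-by-name((★) inside the membership) off the printed `243a1` fibre. What remains
OFF every printed / certified door: cube-sum curves `x³ + y³ = n` that are not one of the bases (`𝒩 ∌ −3`: the
cubic-twist family is not reached), Mordell curves off all families, the five odd Heegner fields (crux 20672,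
door-less: DOSSIER §15.4). Beyond print: NO.

References: route file `Theses/PrintCf2.lean` items 20671, 21366; `WAll/TargetCMTwoInertShuZhaiOneFortyFour.lean`
(p4 g2); `P2/KrizLiSmallCMBase{Transport,}.lean`, `P2/KrizLiCubeSumThirteen{Curve,Slices}.lean` (p3 g3);
[cite: KrizLi2019, Thm. 5.1 (2), Thm. 4.3, Def. 4.1, §6 Ex. 6.2, Table 1, Rem. 6.3]; [cite: Miller2011LMS, Def. 1.1].
-/

noncomputable section

open scoped Classical

open WeierstrassCurve Literature.NumberTheory.EllipticCurves
  Literature.NumberTheory.EllipticCurves.Rank1Residual Literature.NumberTheory.EllipticCurves.ModularForms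
  Literature.NumberTheory.EllipticCurves.KrizLi2019
open Summit.BirchSwinnertonDyer.Rank1Residual

set_option autoImplicit false

namespace Summit.BirchSwinnertonDyer

/-! ### §1. The inert slices cut along the generic Kriz–Li (★)-door -/

/-- **Inert slices ON THE GENERIC KRIZ–LI (★)-DOOR** (closed granted named facts, §3): CM, `ord_{s=1} L(E,s) = 1`,
`2` inert in `K_CM`, `W` `ℚ`-isogenous to a Kriz–Li twist of some small-conductor CM base carrying a (★)-datum
over some Heegner field ⇒ `BSD(E,2)`. [folklore] -/
@[conjecture] def WAllCornerFTwoInertKrizLiStarDoor : Prop :=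
  ∀ (W : WeierstrassCurve ℚ) [W.IsElliptic] [W.IsGloballyMinimal],
    W.HasCM → W.analyticRank = 1 → CMInert W 2 → P2.IsIsogenousToKrizLiTwistOfSmallCMBase W → BSDp W 2

/-- **Inert slices OFF ALL FOUR DOORS (OPEN) — the residual of the inert roads (v4).** CM, `ord_{s=1} L(E,s) = 1`,
`2` inert in `K_CM`, `W` NOT `ℚ`-isogenous to an explicit Shu–Zhai twist of `36a1`, NOT to a Kriz–Li twist of
`243a1`, NOT to an explicit Shu–Zhai twist of `144a1`, and NOT a member of the generic Kriz–Li (★)-door ⇒ `BSD(E,2)`.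
No theorem in print and no certificate reaches it (cube sums off the certified bases, Mordell curves off all
families, the five odd Heegner fields). [folklore] -/
@[conjecture] def WAllCornerFTwoInertOffShuZhaiOffKrizLiOffShuZhaiOneFortyFourOffStarDoor : Prop :=
  ∀ (W : WeierstrassCurve ℚ) [W.IsElliptic] [W.IsGloballyMinimal],
    W.HasCM → W.analyticRank = 1 → CMInert W 2 → ¬ P2.IsIsogenousToShuZhaiThirtySixTwist W →
      ¬ P2.IsIsogenousToKrizLiTwoFortyThreeTwist W → ¬ P2.IsIsogenousToShuZhaiOneFortyFourTwist W →
        ¬ P2.IsIsogenousToKrizLiTwistOfSmallCMBase W → BSDp W 2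

/-! ### §2. The ON-leaf versus the consequent of aside 21366 (memberships equivalent granted facts) -/

/-- **Aside 21366's membership package ⟹ p3's membership**, granted GZK (`r_an(E) = 1 ⟹ 1 ≤ rank_ℤ E(ℚ)`).
[cite: KrizLi2019, Thm. 5.1 (2) (hypothesis list)] -/
theorem isIsogenousToKrizLiTwistOfSmallCMBase_of_starDoorPackage
    (hGZK : rank_eq_analyticRank_of_analyticRank_le_one) {W : WeierstrassCurve ℚ}
    (hW : ∃ (E : WeierstrassCurve ℚ) (_ : E.IsElliptic) (_ : E.IsGloballyMinimal) (_ : NeZero (E.conductorNorm ℤ))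
      (K : Type) (_ : Field K) (_ : NumberField K) (Dt : ModularParametrizationData E (E.conductorNorm ℤ))
      (H : HeegnerDatum (E.conductorNorm ℤ) (NumberField.discr K)) (ι : K →+* ℂ) (P : (E.baseChange K).toAffine.Point)
      (j : K →ₐ[ℚ] ℚ_[2]) (d : ℤ),
      E.HasCM ∧ E.conductorNorm ℤ < 5000 ∧ E.analyticRank = 1 ∧ (∀ Q : E.toAffine.Point, 2 • Q = 0 → Q = 0) ∧
      IsImaginaryQuadratic K ∧ SatisfiesHeegnerHypothesis (E.conductorNorm ℤ) K ∧
      WeierstrassCurve.Affine.Point.map ι.toRatAlgHom P = heegnerPointComplex Dt H ∧ AssumptionStar E Dt K P j ∧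
      (Odd ((E.baseChange ℚ_[2]).localTamagawaNumber ℤ_[2]) ∧
        (¬ E.HasGoodReductionAtPrime 2 → ¬ E.HasMultiplicativeReductionAtPrime 2 → Odd Dt.c)) ∧
      InN E K d ∧ Int.sign d * jacobiSym (E.conductorNorm ℤ) d.natAbs = 1 ∧
      (IsIsogenous W (E.quadraticTwist (d : ℚ)) ∨ IsIsogenous W (E.quadraticTwist ((d * NumberField.discr K : ℤ) : ℚ)))) :
    P2.IsIsogenousToKrizLiTwistOfSmallCMBase W := by
  obtain ⟨E, _, _, _, K, _, _, Dt, H, ι, P, j, d, hcm, hN, hr1, h2, hK, hH, hP, hstar, ⟨hc2, hman⟩, hd, hsign,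
    hiso⟩ := hW
  have hrk : 1 ≤ E.mordellWeilRank := by
    have h := (hGZK E hr1.le).1
    omega
  exact ⟨E, inferInstance, inferInstance, inferInstance, hcm, hN, hrk, h2, hc2, K, inferInstance, inferInstance,
    hK, hH, ⟨Dt, H, ι, P, j, hP, hstar, hman⟩, d, hd, hsign, hiso⟩

/-- **p3's membership ⟹ aside 21366's membership package**, granted Thm 4.3 (`h33`), Burungale–Flach (`hBF`) and
modularity (`hmod`) (`1 ≤ rank_ℤ E(ℚ)` + (★) ⟹ `r_an(E) = 1`). [cite: KrizLi2019, Thm. 4.3 (FMS)] [cite: BurungaleFlach2024, Cor. 2] -/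
theorem starDoorPackage_of_isIsogenousToKrizLiTwistOfSmallCMBase (h33 : thm33_rank_twist)
    (hBF : bsdTriple_of_hasCM_of_L_one_ne_zero) (hmod : hasEntireLFunction_rat) {W : WeierstrassCurve ℚ}
    (hW : P2.IsIsogenousToKrizLiTwistOfSmallCMBase W) :
    ∃ (E : WeierstrassCurve ℚ) (_ : E.IsElliptic) (_ : E.IsGloballyMinimal) (_ : NeZero (E.conductorNorm ℤ))
      (K : Type) (_ : Field K) (_ : NumberField K) (Dt : ModularParametrizationData E (E.conductorNorm ℤ))
      (H : HeegnerDatum (E.conductorNorm ℤ) (NumberField.discr K)) (ι : K →+* ℂ) (P : (E.baseChange K).toAffine.Point)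
      (j : K →ₐ[ℚ] ℚ_[2]) (d : ℤ),
      E.HasCM ∧ E.conductorNorm ℤ < 5000 ∧ E.analyticRank = 1 ∧ (∀ Q : E.toAffine.Point, 2 • Q = 0 → Q = 0) ∧
      IsImaginaryQuadratic K ∧ SatisfiesHeegnerHypothesis (E.conductorNorm ℤ) K ∧
      WeierstrassCurve.Affine.Point.map ι.toRatAlgHom P = heegnerPointComplex Dt H ∧ AssumptionStar E Dt K P j ∧
      (Odd ((E.baseChange ℚ_[2]).localTamagawaNumber ℤ_[2]) ∧
        (¬ E.HasGoodReductionAtPrime 2 → ¬ E.HasMultiplicativeReductionAtPrime 2 → Odd Dt.c)) ∧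
      InN E K d ∧ Int.sign d * jacobiSym (E.conductorNorm ℤ) d.natAbs = 1 ∧
      (IsIsogenous W (E.quadraticTwist (d : ℚ)) ∨ IsIsogenous W (E.quadraticTwist ((d * NumberField.discr K : ℤ) : ℚ))) := by
  obtain ⟨E, _, _, _, hcm, hN, hrk, h2, hc2, K, _, _, hK, hH, hSD, d, hd, hsign, hiso⟩ := hW
  have hr1 : E.analyticRank = 1 := P2.analyticRank_eq_one_of_hasKrizLiStarDatum E h33 hBF hmod hcm hrk h2 K hK hH hSD
  obtain ⟨Dt, H, ι, P, j, hP, hstar, hman⟩ := hSD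
  exact ⟨E, inferInstance, inferInstance, inferInstance, K, inferInstance, inferInstance, Dt, H, ι, P, j, d, hcm, hN,
    hr1, h2, hK, hH, hP, hstar, ⟨hc2, hman⟩, hd, hsign, hiso⟩

/-- **The ON-leaf ⟺ the consequent of aside 21366, granted GZK, Thm 4.3, Burungale–Flach and modularity** (four
conjuncts of the aside's own antecedent), so a proof of either closes the other under the bundle.
[cite: KrizLi2019, Thm. 5.1 (2) and Thm. 4.3] -/
theorem wAllCornerFTwoInertKrizLiStarDoor_iff_item_of_facts (hGZK : rank_eq_analyticRank_of_analyticRank_le_one)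
    (h33 : thm33_rank_twist) (hBF : bsdTriple_of_hasCM_of_L_one_ne_zero) (hmod : hasEntireLFunction_rat) :
    WAllCornerFTwoInertKrizLiStarDoor ↔
      ∀ (W : WeierstrassCurve ℚ) [W.IsElliptic] [W.IsGloballyMinimal], W.HasCM → W.analyticRank = 1 → CMInert W 2 →
        (∃ (E : WeierstrassCurve ℚ) (_ : E.IsElliptic) (_ : E.IsGloballyMinimal) (_ : NeZero (E.conductorNorm ℤ))
          (K : Type) (_ : Field K) (_ : NumberField K) (Dt : ModularParametrizationData E (E.conductorNorm ℤ))
          (H : HeegnerDatum (E.conductorNorm ℤ) (NumberField.discr K)) (ι : K →+* ℂ) (P : (E.baseChange K).toAffine.Point)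
          (j : K →ₐ[ℚ] ℚ_[2]) (d : ℤ),
          E.HasCM ∧ E.conductorNorm ℤ < 5000 ∧ E.analyticRank = 1 ∧ (∀ Q : E.toAffine.Point, 2 • Q = 0 → Q = 0) ∧
          IsImaginaryQuadratic K ∧ SatisfiesHeegnerHypothesis (E.conductorNorm ℤ) K ∧
          WeierstrassCurve.Affine.Point.map ι.toRatAlgHom P = heegnerPointComplex Dt H ∧ AssumptionStar E Dt K P j ∧
          (Odd ((E.baseChange ℚ_[2]).localTamagawaNumber ℤ_[2]) ∧
            (¬ E.HasGoodReductionAtPrime 2 → ¬ E.HasMultiplicativeReductionAtPrime 2 → Odd Dt.c)) ∧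
          InN E K d ∧ Int.sign d * jacobiSym (E.conductorNorm ℤ) d.natAbs = 1 ∧
          (IsIsogenous W (E.quadraticTwist (d : ℚ)) ∨
            IsIsogenous W (E.quadraticTwist ((d * NumberField.discr K : ℤ) : ℚ)))) → BSDp W 2 :=
  ⟨fun h W _ _ hcm hr1 hin hW ↦ h W hcm hr1 hin (isIsogenousToKrizLiTwistOfSmallCMBase_of_starDoorPackage hGZK hW),
    fun h W _ _ hcm hr1 hin hW ↦
      h W hcm hr1 hin (starDoorPackage_of_isIsogenousToKrizLiTwistOfSmallCMBase h33 hBF hmod hW)⟩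

/-! ### §3. The ON-leaf CLOSED granted the named facts; the KL243 leaf is its printed fibre -/

/-- **`WAllCornerFTwoInertKrizLiStarDoor` holds granted, BY NAME: Kriz–Li 2019 Thm 5.1 (2) (`hKL`) and Thm 4.3
(`h33`), Creutz–Miller 2012 (`hS31`), the CM rank-zero row C8 (`hBF`, Burungale–Flach 2024), modularity (`hmod`),
GZK (`hGZK`) and Cassels (`hCassels`)** — five conjuncts of 𝔅_inert and the asides 20767 / 20768; NO table fact
(the (★)-datum is inside the membership). The p3 g3 closer `P2.cornerFTwo_krizLiSmallCMBase_byName` read on the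
leaf. [cite: KrizLi2019, Thm. 5.1 (2), Thm. 4.3] [cite: CreutzMiller2012, Thm. 1.1] [cite: BurungaleFlach2024, Thm. 1.1 and Cor. 2]
[cite: MilneADT2006, Thm. I.7.3] [cite: Miller2011LMS, Def. 1.1] -/
theorem wAllCornerFTwoInertKrizLiStarDoor_of_facts (hKL : thm112_bsdTwo_twist) (h33 : thm33_rank_twist)
    (hS31 : bsdTriple_of_analyticRank_le_one_of_conductor_lt) (hBF : bsdTriple_of_hasCM_of_L_one_ne_zero)
    (hmod : hasEntireLFunction_rat) (hGZK : rank_eq_analyticRank_of_analyticRank_le_one)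
    (hCassels : bsdRHS_eq_of_isIsogenous) : WAllCornerFTwoInertKrizLiStarDoor :=
  fun W _ _ hcm hr1 hin hW ↦ P2.cornerFTwo_krizLiSmallCMBase_byName hKL h33 hS31 hBF hmod hGZK hCassels W hcm hr1 hin hW

/-- **The KL243 leaf is the printed fibre of the (★)-door leaf**: granted the Table-1 row (`htab`), the generic
leaf implies `WAllCornerFTwoInertKrizLiTwoFortyThree`. [cite: KrizLi2019, §6 Table 1 (row 243a1) and Rem. 6.3] -/
theorem wAllCornerFTwoInertKrizLiTwoFortyThree_of_starDoor (htab : table1_row243a1)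
    (h : WAllCornerFTwoInertKrizLiStarDoor) : WAllCornerFTwoInertKrizLiTwoFortyThree :=
  P2.cornerFTwo_krizLiTwoFortyThree_of_smallCMBase htab (fun W _ _ hcm hr1 hin hW ↦ h W hcm hr1 hin hW)

/-! ### §4. Glue (excluded middle on the fourth membership) — every cut EXACT -/

/-- **The v3 residual splits**: `Off³ ⟺ ((★)-door ON it) ∧ Off⁴`, stated as the two useful implications. The v3
residual implies the v4 residual … [folklore] -/
theorem wAllCornerFTwoInertOff4_of_off3 (h : WAllCornerFTwoInertOffShuZhaiOffKrizLiOffShuZhaiOneFortyFour) :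
    WAllCornerFTwoInertOffShuZhaiOffKrizLiOffShuZhaiOneFortyFourOffStarDoor :=
  fun W _ _ hcm hr1 hin h1 h2 h3 _ ↦ h W hcm hr1 hin h1 h2 h3

/-- … and the (★)-door leaf with the v4 residual give back the v3 residual. [folklore] -/
theorem wAllCornerFTwoInertOff3_of_starDoor_of_off4 (hD : WAllCornerFTwoInertKrizLiStarDoor)
    (hO : WAllCornerFTwoInertOffShuZhaiOffKrizLiOffShuZhaiOneFortyFourOffStarDoor) :
    WAllCornerFTwoInertOffShuZhaiOffKrizLiOffShuZhaiOneFortyFour := by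
  intro W _ _ hcm hr1 hin h1 h2 h3
  by_cases h4 : P2.IsIsogenousToKrizLiTwistOfSmallCMBase W
  · exact hD W hcm hr1 hin h4
  · exact hO W hcm hr1 hin h1 h2 h3 h4

/-- **The two inert slices ⟺ ON SZ36 ∧ ON KL243 ∧ ON SZ144 ∧ ON (★)-door ∧ OFF all four** (EXACT; pure logic).
[folklore] -/
theorem wAllCornerFTwoInert_iff_shuZhai_krizLi_shuZhai144_starDoor_off :
    (WAllCornerFTwoInertGood ∧ WAllCornerFTwoInertBad) ↔
      WAllCornerFTwoInertShuZhaiThirtySix ∧ WAllCornerFTwoInertKrizLiTwoFortyThree ∧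
        WAllCornerFTwoInertShuZhaiOneFortyFour ∧ WAllCornerFTwoInertKrizLiStarDoor ∧
          WAllCornerFTwoInertOffShuZhaiOffKrizLiOffShuZhaiOneFortyFourOffStarDoor := by
  rw [wAllCornerFTwoInert_iff_shuZhai_krizLi_shuZhai144_off]
  constructor
  · rintro ⟨hS, hK, h144, hO⟩
    refine ⟨hS, hK, h144, fun W _ _ hcm hr1 hin h4 ↦ ?_, wAllCornerFTwoInertOff4_of_off3 hO⟩
    by_cases h1 : P2.IsIsogenousToShuZhaiThirtySixTwist W
    · exact hS W hcm hr1 hin h1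
    · by_cases h2 : P2.IsIsogenousToKrizLiTwoFortyThreeTwist W
      · exact hK W hcm hr1 hin h2
      · by_cases h3 : P2.IsIsogenousToShuZhaiOneFortyFourTwist W
        · exact h144 W hcm hr1 hin h3
        · exact hO W hcm hr1 hin h1 h2 h3
  · rintro ⟨hS, hK, h144, hD, hO⟩
    exact ⟨hS, hK, h144, wAllCornerFTwoInertOff3_of_starDoor_of_off4 hD hO⟩

/-- The ON-leaf is implied by the row-12₂ leaf (it is a slice of it). [folklore] -/
theorem wAllCornerFTwoInertKrizLiStarDoor_of_wAllCornerFTwo (h : WAllCornerFTwo) : WAllCornerFTwoInertKrizLiStarDoor :=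
  fun W _ _ hcm hr1 _ _ ↦ h W hcm hr1

/-- The OFF⁴-leaf (the residual v4) is implied by the row-12₂ leaf. [folklore] -/
theorem wAllCornerFTwoInertOff4_of_wAllCornerFTwo (h : WAllCornerFTwo) :
    WAllCornerFTwoInertOffShuZhaiOffKrizLiOffShuZhaiOneFortyFourOffStarDoor :=
  fun W _ _ hcm hr1 _ _ _ _ _ ↦ h W hcm hr1

/-- **Row 12₂ ⟺ split-good ∧ split-bad ∧ ramified ∧ (inert ON SZ36) ∧ (ON KL243) ∧ (ON SZ144) ∧ (ON (★)-door) ∧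
(inert OFF all four)** (EXACT). [folklore] -/
theorem wAllCornerFTwo_iff_slices_shuZhai_krizLi_shuZhai144_starDoor :
    WAllCornerFTwo ↔ WAllCornerFTwoSplitGood ∧ WAllCornerFTwoSplitBad ∧ WAllCornerFTwoRamified ∧
      WAllCornerFTwoInertShuZhaiThirtySix ∧ WAllCornerFTwoInertKrizLiTwoFortyThree ∧
        WAllCornerFTwoInertShuZhaiOneFortyFour ∧ WAllCornerFTwoInertKrizLiStarDoor ∧
          WAllCornerFTwoInertOffShuZhaiOffKrizLiOffShuZhaiOneFortyFourOffStarDoor := by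
  rw [wAllCornerFTwo_iff_slices]
  constructor
  · rintro ⟨hSG, hSB, hR, hIG, hIB⟩
    exact ⟨hSG, hSB, hR, wAllCornerFTwoInert_iff_shuZhai_krizLi_shuZhai144_starDoor_off.1 ⟨hIG, hIB⟩⟩
  · rintro ⟨hSG, hSB, hR, h5⟩
    exact ⟨hSG, hSB, hR, wAllCornerFTwoInert_iff_shuZhai_krizLi_shuZhai144_starDoor_off.2 h5⟩

/-- **The sub-lane target `P2.CMNonsplitRankOneAtTwo` ⟺ ramified ∧ (ON SZ36) ∧ (ON KL243) ∧ (ON SZ144) ∧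
(ON (★)-door) ∧ (OFF all four).** [folklore] -/
theorem cmNonsplitRankOneAtTwo_iff_ramified_shuZhai_krizLi_shuZhai144_starDoor_off :
    P2.CMNonsplitRankOneAtTwo ↔
      WAllCornerFTwoRamified ∧ WAllCornerFTwoInertShuZhaiThirtySix ∧ WAllCornerFTwoInertKrizLiTwoFortyThree ∧
        WAllCornerFTwoInertShuZhaiOneFortyFour ∧ WAllCornerFTwoInertKrizLiStarDoor ∧
          WAllCornerFTwoInertOffShuZhaiOffKrizLiOffShuZhaiOneFortyFourOffStarDoor := by
  rw [cmNonsplitRankOneAtTwo_iff_nonsplitSlices]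
  constructor
  · rintro ⟨hR, hIG, hIB⟩
    exact ⟨hR, wAllCornerFTwoInert_iff_shuZhai_krizLi_shuZhai144_starDoor_off.1 ⟨hIG, hIB⟩⟩
  · rintro ⟨hR, h5⟩
    exact ⟨hR, wAllCornerFTwoInert_iff_shuZhai_krizLi_shuZhai144_starDoor_off.2 h5⟩

/-- **After the four ON-leaves, the inert slices ARE the OFF⁴-leaf**: granted proofs of the four door leaves (SZ36,
KL243, SZ144 — each closed granted its named facts elsewhere — and the (★)-door, closed by
`wAllCornerFTwoInertKrizLiStarDoor_of_facts`), the two inert slices of row 12₂ hold iff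
`WAllCornerFTwoInertOffShuZhaiOffKrizLiOffShuZhaiOneFortyFourOffStarDoor` holds. [folklore] -/
theorem wAllCornerFTwoInert_iff_off4_of_leaves (hS : WAllCornerFTwoInertShuZhaiThirtySix)
    (hK : WAllCornerFTwoInertKrizLiTwoFortyThree) (h144 : WAllCornerFTwoInertShuZhaiOneFortyFour)
    (hD : WAllCornerFTwoInertKrizLiStarDoor) :
    (WAllCornerFTwoInertGood ∧ WAllCornerFTwoInertBad) ↔
      WAllCornerFTwoInertOffShuZhaiOffKrizLiOffShuZhaiOneFortyFourOffStarDoor := by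
  rw [wAllCornerFTwoInert_iff_shuZhai_krizLi_shuZhai144_starDoor_off]
  exact ⟨fun h ↦ h.2.2.2.2, fun h ↦ ⟨hS, hK, h144, hD, h⟩⟩

/-- **Granted the eleven facts of the SZ36 and KL-door closures (+ the KL Table-1 row) and a proof of the SZ144
leaf, the inert slices ARE the OFF⁴-leaf** — the KL243 leaf being derived from the (★)-door leaf and `htab`.
[cite: KrizLi2019, Thm. 5.1 (2), Thm. 4.3, §6 Table 1 row 243a1] [cite: ShuZhai2021, Thm. 1.2 and Thm. 1.4] -/
theorem wAllCornerFTwoInert_iff_off4_of_facts (hCassels : bsdRHS_eq_of_isIsogenous)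
    (h12 : ShuZhai2021.thm12_ranks_of_twists) (h14 : ShuZhai2021.thm14_twoPartBSD_of_twists)
    (hBF : bsdTriple_of_hasCM_of_L_one_ne_zero) (hmod : hasEntireLFunction_rat)
    (hARS : AgasheRibetStein2006.cremona_abs_maninConstant_eq_one_of_level_le) (htab36 : ShuZhai2021.table52_row36a1)
    (hKL : thm112_bsdTwo_twist) (h33 : thm33_rank_twist) (htab243 : table1_row243a1)
    (hS31 : bsdTriple_of_analyticRank_le_one_of_conductor_lt) (hGZK : rank_eq_analyticRank_of_analyticRank_le_one)
    (h144 : WAllCornerFTwoInertShuZhaiOneFortyFour) :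
    (WAllCornerFTwoInertGood ∧ WAllCornerFTwoInertBad) ↔
      WAllCornerFTwoInertOffShuZhaiOffKrizLiOffShuZhaiOneFortyFourOffStarDoor :=
  have hD := wAllCornerFTwoInertKrizLiStarDoor_of_facts hKL h33 hS31 hBF hmod hGZK hCassels
  wAllCornerFTwoInert_iff_off4_of_leaves
    (wAllCornerFTwoInertShuZhaiThirtySix_of_facts hCassels h12 h14 hBF hmod hARS htab36)
    (wAllCornerFTwoInertKrizLiTwoFortyThree_of_starDoor htab243 hD) h144 hD

end Summit.BirchSwinnertonDyer

end
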